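import Summits.HodgeConjecture.HodgeConjecture.Theorems.EightfoldBlochSeedsReachHyperbolicRiemannRealisableStubs
import HarnessLib

/-!
# Crux `SimilarReach` (item stmt-HodgeConjecture-23605; routes `KleimanBFSeeds`, `DoublyPolarisedTransport`, `RealMultiplicationPencil`),
# line `moduli-riemann` (`Cruxes/SimilarReach/Lines/moduli_riemann.lean` 21539e5c3d17774a): its registered stubs `stub_riemannRealisable`
# and `stub_rung_riemannSurfaces` BY NAME — the SAME statements as the sibling crux `ReachHyperbolic`'s (stmt-18883), already proved

HONEST FRAMING. The sibling skeletons `Cruxes/ReachHyperbolic/Lines/moduli_riemann.lean` and `Cruxes/SimilarReach/Lines/moduli_riemann.lean`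
(same line-writer seat) declare `RealisedBy` / `RiemannRealisableAt` with IDENTICAL bodies (now the route Defs vocabulary
`Theorems.EightfoldBlochSeeds.RiemannRealisableAt`, `Theorems/EightfoldBlochSeedsDefs.lean`) and register the same two transcendental stubs.
Riemann's existence theorem at Weil type is proved in the tree (`Theorems.exists_realisedBy_of_isWeilComplexStructure`, landed for 18883 as
`Theorems.stub_riemannRealisable`); this file re-exports it under this crux's stub names in a separate namespace. Nothing here proves
`stub_moduliComplete`, `stub_rung_surfaces`, the crux `SimilarReach`, rung H2, K-C⁺, HC_AV or HC. No definition, no named fact (D-0026).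

[cite: DeligneMilne1982Tannakian, art. II §6 Thm. 6.20 (Riemann)] [cite: Shimura1998, §7.1 Prop. 7]
-/

noncomputable section

-- single-problem summit (Problem = Summit): the mandated namespace repeats `HodgeConjecture`.
set_option linter.dupNamespace false

open Summit.HodgeConjecture.HodgeConjecture.Theorems.EightfoldBlochSeeds

namespace Summit.HodgeConjecture.HodgeConjecture.Theorems.SimilarReachLine

/-- **`stub_riemannRealisable` of crux `SimilarReach`: Riemann's existence theorem at Weil type `(n, n)`, every `n, d ≥ 1`** (same
statement as the sibling `ReachHyperbolic` stub; proof `Theorems.stub_riemannRealisable`). [cite: DeligneMilne1982Tannakian, art. II §6 Thm. 6.20 (Riemann)] -/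
theorem stub_riemannRealisable : ∀ (n d : ℕ), 1 ≤ n → 1 ≤ d → RiemannRealisableAt n d :=
  Summit.HodgeConjecture.HodgeConjecture.Theorems.stub_riemannRealisable

/-- **`stub_rung_riemannSurfaces` of crux `SimilarReach`: the surface rung `n = 1`** (proof `Theorems.stub_rung_riemannSurfaces`).
[cite: DeligneMilne1982Tannakian, art. II §6 Thm. 6.20 (Riemann)] -/
theorem stub_rung_riemannSurfaces : ∀ (d : ℕ), 1 ≤ d → RiemannRealisableAt 1 d :=
  Summit.HodgeConjecture.HodgeConjecture.Theorems.stub_rung_riemannSurfaces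

end Summit.HodgeConjecture.HodgeConjecture.Theorems.SimilarReachLine

end
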